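import Literature.NumberTheory.Automorphic.ArchWeightVectorRotation
import Literature.NumberTheory.Automorphic.ArchKirillovODEGL2Complex
import HarnessLib

/-!
# Integrality of the `K_∞`-weights of Gårding vectors of `GL₂(K_∞)` (one-parameter compact subgroups
# of period `2π`)

Topic `NumberTheory/Automorphic`; namespace `Literature.NumberTheory.Automorphic`. Theorems only (no
definition, no named fact, no instance). Step P1d of the archimedean test-vector selection of the
Hecke theory of `GL₂` (Jacquet–Langlands (1970), Thm. 5.15; toward the named fact
`JacquetLanglands1970_twistedHeckeTheoryGL2`). For a compact one-parameter subgroup `exp(tJ)` with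
`J² = -P`, `P J = J` (`P` an idempotent), `exp(2πJ) = 1` (`ArchWeightVectorRotation.exp_smul_eq_of_sq_eq_neg`),
so an eigenvalue `c` of `τ(J)` on a non-zero Gårding vector satisfies `e^{2πc} = 1`, i.e. `c ∈ iℤ`
(`ArchWeightVectorRotation.apply_expGL_smul_eq_exp_smul`):

* `expGL_two_pi_smul_eq_one` — `exp(2πJ) = 1` and `expGL_pi_smul_eq` — `exp(πJ) = 1 - 2P`;
* `exists_int_of_archDerivE_eq_smul` — `τ(J) v = c v`, `v ≠ 0` ⟹ `c = ik`, `k ∈ ℤ`;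
* the letters: `weylR_sq` (`W_w = (E₀₁ - E₁₀) ⊗ 1_w`, `W² = -(E₀₀ + E₁₁) ⊗ 1_w`), `torusC_sq`
  (`T_w = (E₀₀ - E₁₁) ⊗ i_w`, `T² = -(E₀₀ + E₁₁) ⊗ 1_w`), `cornerC_sq` (`E₀₀ ⊗ i_w`), `centerC_sq`
  (`1 ⊗ i_w`), with the corresponding integrality statements `exists_int_weylR`, `exists_int_torusC`,
  `exists_int_cornerC`, `exists_int_centerC`;
* `expGL_pi_smul_torusC_eq_expGL_pi_smul_centerC` — `exp(πT_w) = exp(π(1 ⊗ i_w)) = 1 - 2 (1 ⊗ 1_w)`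
  (both are "`-1` at the place `w`"), whence the **parity relation** `exists_int_torusC_sub_centerC`:
  if `τ(T_w) v = im v` and `τ(1 ⊗ i_w) v = μ₂ v` with `v ≠ 0` then `im - μ₂ ∈ 2iℤ`.

## References

* H. Jacquet, R. P. Langlands, *Automorphic Forms on GL(2)*, LNM 114 (1970), §5 (weights of the
  representations of `GL₂(ℝ)`, Lemma 5.6) and §6. [JacquetLanglands1970]
* A. W. Knapp, *Representation Theory of Semisimple Groups* (1986), Ch. II §§5–6 (`K`-types of
  `SL₂(ℝ)`, `SL₂(ℂ)`). [Knapp1986]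
-/

noncomputable section

open NumberField NumberField.InfinitePlace NumberField.mixedEmbedding IsDedekindDomain Set Filter
open scoped MatrixGroups Topology Classical

namespace Literature.NumberTheory.Automorphic

variable {K : Type} [Field K] [NumberField K]

-- as in `ArchGardingWhittaker`
set_option backward.isDefEq.respectTransparency false

/-! ### 1. One-parameter subgroups of period `2π` -/

section Period

open scoped Matrix.Norms.Operator in
/-- **`exp(2πJ) = 1`** for `J² = -P`, `P J = J`. [folklore] -/
theorem expGL_two_pi_smul_eq_one {J P : Matrix (Fin 2) (Fin 2) (mixedSpace K)} (hJ : J * J = -P) (hPJ : P * J = J) :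
    expGL ((2 * Real.pi) • J) = 1 := by
  refine Units.ext ?_
  rw [coe_expGL, exp_smul_eq_of_sq_eq_neg hJ hPJ, Units.val_one, Real.cos_two_pi, Real.sin_two_pi, sub_self, zero_smul,
    zero_smul, add_zero, add_zero]

open scoped Matrix.Norms.Operator in
/-- **`exp(πJ) = 1 - 2P`** for `J² = -P`, `P J = J` ("`-1` on the corner `P`"). [folklore] -/
theorem coe_expGL_pi_smul {J P : Matrix (Fin 2) (Fin 2) (mixedSpace K)} (hJ : J * J = -P) (hPJ : P * J = J) :
    ((expGL (Real.pi • J) : GL (Fin 2) (mixedSpace K)) : Matrix (Fin 2) (Fin 2) (mixedSpace K)) = 1 - (2 : ℝ) • P := by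
  rw [coe_expGL, exp_smul_eq_of_sq_eq_neg hJ hPJ, Real.cos_pi, Real.sin_pi, zero_smul, add_zero]
  rw [show (-1 - 1 : ℝ) = -2 by norm_num, neg_smul, sub_eq_add_neg]

variable {hcpt : isCompact_glFiniteIntegralLevel 2 K}
  {E : Type*} [NormedAddCommGroup E] [NormedSpace ℂ E] [CompleteSpace E]
  {τ : ContRepresentation ℂ (AutomorphyDatum.gl 2 K hcpt).arch.carrier E}
  (hτ : τ.IsStronglyContinuous)

include hτ in
/-- **Eigenvalues of the generator of a compact one-parameter subgroup are in `iℤ`**: if `J² = -P`,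
`P J = J`, and `τ(J) v = c v` for a non-zero Gårding vector `v`, then `c = ik` for an integer `k`
(`v = τ(exp 2πJ) v = e^{2πc} v`). [cite: Knapp1986, Ch. II §5] -/
theorem exists_int_of_gardingEnd_eq_smul {J P : Matrix (Fin 2) (Fin 2) (mixedSpace K)} (hJ : J * J = -P) (hPJ : P * J = J)
    {v : archGardingSpace hcpt τ} (hv : v ≠ 0) {c : ℂ} (hc : gardingEnd hτ J v = c • v) :
    ∃ k : ℤ, c = Complex.I * k := by
  have hX : archDerivE hcpt τ J (v : E) = c • (v : E) := by
    have h := congrArg Subtype.val hc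
    simpa only [coe_gardingEnd_apply, Submodule.coe_smul] using h
  have h := apply_expGL_smul_eq_exp_smul (hcpt := hcpt) (τ := τ) hτ J v.2 hX (2 * Real.pi)
  rw [expGL_two_pi_smul_eq_one hJ hPJ] at h
  have h1 : τ (toArch hcpt (1 : GL (Fin 2) (mixedSpace K))) (v : E) = v := by
    change τ 1 (v : E) = v; rw [map_one]; rfl
  rw [h1] at h
  have hv' : (v : E) ≠ 0 := fun h0 => hv (Subtype.ext h0)
  have hexp : Complex.exp (c * (2 * Real.pi : ℝ)) = 1 := by
    by_contra hne
    apply hv'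
    have h2 : (1 - Complex.exp (c * (2 * Real.pi : ℝ))) • (v : E) = 0 := by
      rw [sub_smul, one_smul, ← h, sub_self]
    rcases smul_eq_zero.1 h2 with h3 | h3
    · exact absurd (sub_eq_zero.1 h3).symm hne
    · exact h3
  have hexp' : Complex.exp (c * (2 * Real.pi)) = 1 := by
    rw [← hexp]; push_cast; ring_nf
  obtain ⟨k, hk⟩ := Complex.exp_eq_one_iff.1 hexp'
  have hπ : (2 * Real.pi : ℂ) ≠ 0 := by exact_mod_cast Real.two_pi_pos.ne'
  refine ⟨k, mul_right_cancel₀ hπ ?_⟩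
  rw [hk]; ring

end Period

/-! ### 2. The letters of `GL₂(K_∞)`: squares of the compact generators -/

section Letters

omit [NumberField K] in
/-- `W_w² = -(E₀₀ + E₁₁) ⊗ 1_w` and `((E₀₀ + E₁₁) ⊗ 1_w) W_w = W_w` for a real place `w`. [folklore] -/
theorem weylR_sq (w : {w : InfinitePlace K // IsReal w}) :
    (Matrix.single (0 : Fin 2) (1 : Fin 2) ((Pi.single w 1, 0) : mixedSpace K) - Matrix.single 1 0 ((Pi.single w 1, 0) : mixedSpace K)) *
        (Matrix.single (0 : Fin 2) (1 : Fin 2) ((Pi.single w 1, 0) : mixedSpace K) - Matrix.single 1 0 ((Pi.single w 1, 0) : mixedSpace K)) =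
      -(Matrix.single (0 : Fin 2) (0 : Fin 2) ((Pi.single w 1, 0) : mixedSpace K) + Matrix.single 1 1 ((Pi.single w 1, 0) : mixedSpace K)) ∧
    (Matrix.single (0 : Fin 2) (0 : Fin 2) ((Pi.single w 1, 0) : mixedSpace K) + Matrix.single 1 1 ((Pi.single w 1, 0) : mixedSpace K)) *
        (Matrix.single (0 : Fin 2) (1 : Fin 2) ((Pi.single w 1, 0) : mixedSpace K) - Matrix.single 1 0 ((Pi.single w 1, 0) : mixedSpace K)) =
      Matrix.single (0 : Fin 2) (1 : Fin 2) ((Pi.single w 1, 0) : mixedSpace K) - Matrix.single 1 0 ((Pi.single w 1, 0) : mixedSpace K) := by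
  have hrr : ((Pi.single w 1, 0) : mixedSpace K) * (Pi.single w 1, 0) = (Pi.single w 1, 0) := realIdem_mul_self w
  have hA : ∀ (x y : mixedSpace K) (i : Fin 2), Matrix.single i 0 x * Matrix.single 1 (0 : Fin 2) y = 0 :=
    fun x y i => Matrix.single_mul_single_of_ne (h := by decide) (c := x) i 0 1 y
  have hD : ∀ (x y : mixedSpace K) (i : Fin 2), Matrix.single i 1 x * Matrix.single 0 (1 : Fin 2) y = 0 :=
    fun x y i => Matrix.single_mul_single_of_ne (h := by decide) (c := x) i 1 0 y
  refine ⟨?_, ?_⟩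
  · simp only [mul_sub, sub_mul, Matrix.single_mul_single_same, hA, hD, hrr, neg_add]
    abel
  · simp only [add_mul, mul_sub, Matrix.single_mul_single_same, hA, hD, hrr]
    abel

omit [NumberField K] in
/-- `J² = -(E₀₀ + E₁₁) ⊗ 1_w`-type identities at a complex place `w`: for `T_w = (E₀₀ - E₁₁) ⊗ i_w`,
for the corner `E₀₀ ⊗ i_w` (with `P = E₀₀ ⊗ 1_w`) and for the centre `1 ⊗ i_w` (with `P = 1 ⊗ 1_w`). [folklore] -/
theorem torusC_sq (w : {w : InfinitePlace K // IsComplex w}) :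
    ((Matrix.single (0 : Fin 2) (0 : Fin 2) ((0, Pi.single w Complex.I) : mixedSpace K) - Matrix.single 1 1 ((0, Pi.single w Complex.I) : mixedSpace K)) *
        (Matrix.single (0 : Fin 2) (0 : Fin 2) ((0, Pi.single w Complex.I) : mixedSpace K) - Matrix.single 1 1 ((0, Pi.single w Complex.I) : mixedSpace K)) =
      -(Matrix.single (0 : Fin 2) (0 : Fin 2) ((0, Pi.single w 1) : mixedSpace K) + Matrix.single 1 1 ((0, Pi.single w 1) : mixedSpace K)) ∧
    (Matrix.single (0 : Fin 2) (0 : Fin 2) ((0, Pi.single w 1) : mixedSpace K) + Matrix.single 1 1 ((0, Pi.single w 1) : mixedSpace K)) *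
        (Matrix.single (0 : Fin 2) (0 : Fin 2) ((0, Pi.single w Complex.I) : mixedSpace K) - Matrix.single 1 1 ((0, Pi.single w Complex.I) : mixedSpace K)) =
      Matrix.single (0 : Fin 2) (0 : Fin 2) ((0, Pi.single w Complex.I) : mixedSpace K) - Matrix.single 1 1 ((0, Pi.single w Complex.I) : mixedSpace K)) ∧
    (Matrix.single (0 : Fin 2) (0 : Fin 2) ((0, Pi.single w Complex.I) : mixedSpace K) * Matrix.single (0 : Fin 2) (0 : Fin 2) ((0, Pi.single w Complex.I) : mixedSpace K) =
      -Matrix.single (0 : Fin 2) (0 : Fin 2) ((0, Pi.single w 1) : mixedSpace K) ∧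
    Matrix.single (0 : Fin 2) (0 : Fin 2) ((0, Pi.single w 1) : mixedSpace K) * Matrix.single (0 : Fin 2) (0 : Fin 2) ((0, Pi.single w Complex.I) : mixedSpace K) =
      Matrix.single (0 : Fin 2) (0 : Fin 2) ((0, Pi.single w Complex.I) : mixedSpace K)) ∧
    (((1 : Matrix (Fin 2) (Fin 2) (mixedSpace K)) * Matrix.diagonal (fun _ => ((0, Pi.single w Complex.I) : mixedSpace K))) = Matrix.diagonal (fun _ => ((0, Pi.single w Complex.I) : mixedSpace K)) ∧
    Matrix.diagonal (fun _ : Fin 2 => ((0, Pi.single w Complex.I) : mixedSpace K)) * Matrix.diagonal (fun _ => ((0, Pi.single w Complex.I) : mixedSpace K)) =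
      -Matrix.diagonal (fun _ : Fin 2 => ((0, Pi.single w 1) : mixedSpace K)) ∧
    Matrix.diagonal (fun _ : Fin 2 => ((0, Pi.single w 1) : mixedSpace K)) * Matrix.diagonal (fun _ => ((0, Pi.single w Complex.I) : mixedSpace K)) =
      Matrix.diagonal (fun _ : Fin 2 => ((0, Pi.single w Complex.I) : mixedSpace K))) := by
  have hii := complexIdemI_mul_self (K := K) w
  have hci := complexIdem_mul_complexIdemI (K := K) w
  have hB : ∀ (x y : mixedSpace K) (i : Fin 2), Matrix.single i 0 x * Matrix.single 1 (1 : Fin 2) y = 0 :=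
    fun x y i => Matrix.single_mul_single_of_ne (h := by decide) (c := x) i 0 1 y
  have hC : ∀ (x y : mixedSpace K) (i : Fin 2), Matrix.single i 1 x * Matrix.single 0 (0 : Fin 2) y = 0 :=
    fun x y i => Matrix.single_mul_single_of_ne (h := by decide) (c := x) i 1 0 y
  refine ⟨⟨?_, ?_⟩, ⟨?_, ?_⟩, Matrix.one_mul _, ?_, ?_⟩
  · simp only [mul_sub, sub_mul, Matrix.single_mul_single_same, hB, hC, hii, neg_add, ← Matrix.single_neg]
    abel
  · simp only [add_mul, mul_sub, Matrix.single_mul_single_same, hB, hC, hci]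
    abel
  · rw [Matrix.single_mul_single_same, hii, Matrix.single_neg]
  · rw [Matrix.single_mul_single_same, hci]
  · rw [Matrix.diagonal_mul_diagonal, Matrix.diagonal_neg]
    simp only [hii]
  · rw [Matrix.diagonal_mul_diagonal]
    simp only [hci]

/-- **`exp(πT_w) = exp(π (1 ⊗ i_w))`**: both equal `1 - 2(1 ⊗ 1_w)`, the element "`-1` at the place
`w`". [folklore] -/
theorem expGL_pi_smul_torusC_eq (w : {w : InfinitePlace K // IsComplex w}) :
    expGL (Real.pi • (Matrix.single (0 : Fin 2) (0 : Fin 2) ((0, Pi.single w Complex.I) : mixedSpace K) - Matrix.single 1 1 ((0, Pi.single w Complex.I) : mixedSpace K))) =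
      expGL (Real.pi • Matrix.diagonal (fun _ : Fin 2 => ((0, Pi.single w Complex.I) : mixedSpace K))) := by
  obtain ⟨⟨hT, hPT⟩, -, -, hZ, hPZ⟩ := torusC_sq (K := K) w
  refine Units.ext ?_
  rw [coe_expGL_pi_smul hT hPT, coe_expGL_pi_smul hZ hPZ]
  congr 2
  refine Matrix.ext fun i j => ?_
  fin_cases i <;> fin_cases j <;> simp

end Letters

/-! ### 3. Integrality statements -/

section Integrality

variable {hcpt : isCompact_glFiniteIntegralLevel 2 K}
  {E : Type*} [NormedAddCommGroup E] [NormedSpace ℂ E] [CompleteSpace E]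
  {τ : ContRepresentation ℂ (AutomorphyDatum.gl 2 K hcpt).arch.carrier E}
  (hτ : τ.IsStronglyContinuous)

include hτ in
/-- **Real places: weights are integers.** If `τ(W_w) v = c v` for a non-zero Gårding vector then
`c = ik`, `k ∈ ℤ`. [cite: JacquetLanglands1970, Lemma 5.6] -/
theorem exists_int_weylR (w : {w : InfinitePlace K // IsReal w}) {v : archGardingSpace hcpt τ} (hv : v ≠ 0) {c : ℂ}
    (hc : gardingEnd hτ (Matrix.single (0 : Fin 2) (1 : Fin 2) ((Pi.single w 1, 0) : mixedSpace K) - Matrix.single 1 0 ((Pi.single w 1, 0) : mixedSpace K)) v = c • v) :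
    ∃ k : ℤ, c = Complex.I * k :=
  exists_int_of_gardingEnd_eq_smul hτ (weylR_sq w).1 (weylR_sq w).2 hv hc

include hτ in
/-- **Complex places: torus weights are integers.** If `τ(T_w) v = c v` for a non-zero Gårding vector
then `c = im`, `m ∈ ℤ`. [cite: JacquetLanglands1970, §6] -/
theorem exists_int_torusC (w : {w : InfinitePlace K // IsComplex w}) {v : archGardingSpace hcpt τ} (hv : v ≠ 0) {c : ℂ}
    (hc : gardingEnd hτ (Matrix.single (0 : Fin 2) (0 : Fin 2) ((0, Pi.single w Complex.I) : mixedSpace K) - Matrix.single 1 1 ((0, Pi.single w Complex.I) : mixedSpace K)) v = c • v) :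
    ∃ m : ℤ, c = Complex.I * m :=
  exists_int_of_gardingEnd_eq_smul hτ (torusC_sq w).1.1 (torusC_sq w).1.2 hv hc

include hτ in
/-- **Complex places: corner weights are integers.** If `τ(E₀₀ ⊗ i_w) v = q v` for a non-zero Gårding
vector then `q = in`, `n ∈ ℤ` (the character of `diag(e^{it}, 1)`). [cite: JacquetLanglands1970, §6] -/
theorem exists_int_cornerC (w : {w : InfinitePlace K // IsComplex w}) {v : archGardingSpace hcpt τ} (hv : v ≠ 0) {q : ℂ}
    (hq : gardingEnd hτ (Matrix.single (0 : Fin 2) (0 : Fin 2) ((0, Pi.single w Complex.I) : mixedSpace K)) v = q • v) :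
    ∃ n : ℤ, q = Complex.I * n :=
  exists_int_of_gardingEnd_eq_smul hτ (torusC_sq w).2.1.1 (torusC_sq w).2.1.2 hv hq

include hτ in
/-- **Complex places: the `U(1)`-part of the central character is integral.** If `τ(1 ⊗ i_w) v = μ₂ v`
for a non-zero Gårding vector then `μ₂ = iN`, `N ∈ ℤ`. [cite: JacquetLanglands1970, §6] -/
theorem exists_int_centerC (w : {w : InfinitePlace K // IsComplex w}) {v : archGardingSpace hcpt τ} (hv : v ≠ 0) {μ₂ : ℂ}
    (hμ : gardingEnd hτ (Matrix.diagonal (fun _ : Fin 2 => ((0, Pi.single w Complex.I) : mixedSpace K))) v = μ₂ • v) :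
    ∃ N : ℤ, μ₂ = Complex.I * N :=
  exists_int_of_gardingEnd_eq_smul hτ (torusC_sq w).2.2.2.1 (torusC_sq w).2.2.2.2 hv hμ

include hτ in
/-- **The parity relation at a complex place**: if `τ(T_w) v = c v` and `τ(1 ⊗ i_w) v = μ₂ v` for a
non-zero Gårding vector `v`, then `c - μ₂ ∈ 2iℤ` (`exp(πT_w) = exp(π(1 ⊗ i_w))` acts on `v` by
`e^{πc} = e^{πμ₂}`). [cite: JacquetLanglands1970, §6] -/
theorem exists_int_torusC_sub_centerC (w : {w : InfinitePlace K // IsComplex w}) {v : archGardingSpace hcpt τ} (hv : v ≠ 0)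
    {c μ₂ : ℂ}
    (hc : gardingEnd hτ (Matrix.single (0 : Fin 2) (0 : Fin 2) ((0, Pi.single w Complex.I) : mixedSpace K) - Matrix.single 1 1 ((0, Pi.single w Complex.I) : mixedSpace K)) v = c • v)
    (hμ : gardingEnd hτ (Matrix.diagonal (fun _ : Fin 2 => ((0, Pi.single w Complex.I) : mixedSpace K))) v = μ₂ • v) :
    ∃ k : ℤ, c - μ₂ = 2 * Complex.I * k := by
  have hX : archDerivE hcpt τ (Matrix.single (0 : Fin 2) (0 : Fin 2) ((0, Pi.single w Complex.I) : mixedSpace K) -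
      Matrix.single 1 1 ((0, Pi.single w Complex.I) : mixedSpace K)) (v : E) = c • (v : E) := by
    have h := congrArg Subtype.val hc
    simpa only [coe_gardingEnd_apply, Submodule.coe_smul] using h
  have hY : archDerivE hcpt τ (Matrix.diagonal (fun _ : Fin 2 => ((0, Pi.single w Complex.I) : mixedSpace K))) (v : E) = μ₂ • (v : E) := by
    have h := congrArg Subtype.val hμ
    simpa only [coe_gardingEnd_apply, Submodule.coe_smul] using h
  have h1 := apply_expGL_smul_eq_exp_smul (hcpt := hcpt) (τ := τ) hτ _ v.2 hX Real.pi
  have h2 := apply_expGL_smul_eq_exp_smul (hcpt := hcpt) (τ := τ) hτ _ v.2 hY Real.pi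
  rw [expGL_pi_smul_torusC_eq w] at h1
  rw [h1] at h2
  have hv' : (v : E) ≠ 0 := fun h0 => hv (Subtype.ext h0)
  have hexp : Complex.exp ((c - μ₂) * Real.pi) = 1 := by
    have h3 : (Complex.exp (c * (Real.pi : ℝ)) - Complex.exp (μ₂ * (Real.pi : ℝ))) • (v : E) = 0 := by
      rw [sub_smul, h2, sub_self]
    rcases smul_eq_zero.1 h3 with h4 | h4
    · rw [sub_eq_zero] at h4
      have h5 : Complex.exp (c * Real.pi) * Complex.exp (-(μ₂ * Real.pi)) = 1 := by
        rw [h4, ← Complex.exp_add, add_neg_cancel, Complex.exp_zero]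
      rw [← Complex.exp_add] at h5
      rw [show (c - μ₂) * (Real.pi : ℂ) = c * Real.pi + -(μ₂ * Real.pi) by ring]
      exact h5
    · exact absurd h4 hv'
  obtain ⟨k, hk⟩ := Complex.exp_eq_one_iff.1 hexp
  have hπ : (Real.pi : ℂ) ≠ 0 := by exact_mod_cast Real.pi_pos.ne'
  refine ⟨k, mul_right_cancel₀ hπ ?_⟩
  rw [hk]; ring

end Integrality

end Literature.NumberTheory.Automorphic
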